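import Summits.NavierStokesRegularity.NavierStokesRegularity.Theorems.QuantisedSymmetryPolyhedralDssProfileExistsStubSmoothRepresentativeAe
import Summits.NavierStokesRegularity.NavierStokesRegularity.Theorems.QuantisedSymmetryPolyhedralDssProfileExistsStubTransportAe
import Summits.NavierStokesRegularity.NavierStokesRegularity.Theorems.QuantisedSymmetryPolyhedralDssProfileExistsStubCellConcatenation
import Literature.Analysis.FluidPDE.OseenMildUniqueness
import HarnessLib

/-!
# Every negative slice of a witness is nontrivial — crux stmt-NavierStokesRegularity-1404
  (`QuantisedSymmetry.PolyhedralDssProfileExists`), line polyhedral_cell, stub stub_sliceNonzero (N4)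

Registered stub `stub_sliceNonzero` (`--supports stmt-NavierStokesRegularity-1404`). If an ancient
mild solution `u` of 3-D Navier–Stokes (duality form, measurable slices), exactly `c`-DSS (`c > 1`)
with a Type-I space–time bound, has ONE negative slice `u(t₁)` a.e. zero, then ALL its negative
slices are a.e. zero. So the crux's nontriviality `¬ ∀ t < 0, u t =ᵐ 0` upgrades to
`∀ t < 0, ¬ u t =ᵐ 0` for witnesses.

Proof. Take the smooth Oseen-gauge representative `V` of `u` (`stub_smoothRepresentative_ae`:
`IsTypeIAncientMild C V`, `V(t) = u(t)` a.e. for every `t < 0`, `V = 0` for `t ≥ 0`); it is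
exactly `c`-DSS (`stub_transport_ae` with the trivial group). The slice `V(t₁)` is continuous and
a.e. zero, hence zero. FORWARD on `(t₁, 0)`: on every `(t₁, t₂)`, `t₂ < 0`, both `V` and the zero
field are bounded solutions of the Oseen integral equation from the common datum
`V(t₁) = 0` (`IsTypeIAncientMild.mild_eq` for `V` and for `0`, `isTypeIAncientMild_zero`), so they
agree a.e. (`oseenMild_bounded_unique`, KNSS 2009 §4), hence everywhere by continuity. BACKWARD
for `t ≤ t₁`: the self-similarity `V(s, y) = c V(c² s, c y)` read downwards,
`V(c² s, z) = c⁻¹ V(s, c⁻¹ z)`, propagates the vanishing from `((c²)ᵏ t₁, 0)` to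
`((c²)ᵏ⁺¹ t₁, 0)`, and `(c²)ᵏ → ∞`. Finally `u(t) = V(t) = 0` a.e.
-/

noncomputable section

-- the summit namespace `…NavierStokesRegularity.NavierStokesRegularity…` is the tree convention (D-0017)
set_option linter.dupNamespace false

namespace Summit.NavierStokesRegularity.NavierStokesRegularity.Theorems.PolyhedralDssProfileExists.PolyhedralCell

open MeasureTheory Set Function Filter Topology
open Literature.Analysis Literature.Analysis.FluidPDE

/-! ### Forward uniqueness from a vanishing slice -/

/-- **Forward propagation of a zero slice.** If `V` is a Type-I ancient mild field in the Oseen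
gauge and `V(t₁) = 0` for some `t₁ < 0`, then `V(t) = 0` for every `t ∈ (t₁, 0)`: on `(t₁, t₂)`
(`t < t₂ < 0`) both `V` and the zero field are jointly measurable, bounded by `C/√(-t₂)`, and solve
the Oseen integral equation `w(t) = e^{(t-t₁)Δ} V(t₁) - B¹_{t₁}(w, w)(t)` from the common datum, so
they agree a.e. by uniqueness of bounded Oseen-mild solutions, hence everywhere (continuous slices).
[cite: KochNadirashviliSereginSverak2009, §4] -/
theorem sliceNonzero_forward {C : ℝ} {V : ℝ → EuclideanSpace ℝ (Fin 3) → EuclideanSpace ℝ (Fin 3)}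
    (hV : IsTypeIAncientMild C V) {t₁ : ℝ} (hV1 : V t₁ = 0) :
    ∀ t ∈ Ioo t₁ 0, V t = 0 := by
  intro t ht
  have ht0 : t < 0 := ht.2
  -- an intermediate right end point `t < t₂ < 0`
  set t₂ : ℝ := t / 2 with ht₂
  have ht₂0 : t₂ < 0 := by rw [ht₂]; linarith
  have htt₂ : t < t₂ := by rw [ht₂]; linarith
  have hZ : IsTypeIAncientMild C (0 : ℝ → EuclideanSpace ℝ (Fin 3) → EuclideanSpace ℝ (Fin 3)) :=
    isTypeIAncientMild_zero hV.nonneg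
  set M : ℝ := C / Real.sqrt (-t₂) with hM
  have hM0 : 0 ≤ M := div_nonneg hV.nonneg (Real.sqrt_nonneg _)
  -- the two Oseen identities from the common datum `V t₁ = 0` at `s = t₁`
  have hu : ∀ τ ∈ Ioo t₁ t₂, V τ =ᵐ[volume] fun x =>
      heatFlow (V t₁) (τ - t₁) x - oseenDuhamel 1 t₁ V V τ x :=
    fun τ hτ => Eventually.of_forall fun x => hV.mild_eq hτ.1 (hτ.2.trans ht₂0) x
  have hv : ∀ τ ∈ Ioo t₁ t₂, (0 : ℝ → EuclideanSpace ℝ (Fin 3) → EuclideanSpace ℝ (Fin 3)) τ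
      =ᵐ[volume] fun x => heatFlow (V t₁) (τ - t₁) x - oseenDuhamel 1 t₁ 0 0 τ x := by
    intro τ hτ
    refine Eventually.of_forall fun x => ?_
    have h := hZ.mild_eq hτ.1 (hτ.2.trans ht₂0) x
    rw [hV1]
    exact h
  have hae : V t =ᵐ[volume] (0 : ℝ → EuclideanSpace ℝ (Fin 3) → EuclideanSpace ℝ (Fin 3)) t :=
    oseenMild_bounded_unique one_pos hM0 (hV.aestronglyMeasurable_uncurry ht₂0.le)
      (hZ.aestronglyMeasurable_uncurry ht₂0.le)
      (fun τ hτ y => hV.norm_le_of_mem_Ioo ht₂0 hτ y) (fun τ hτ y => hZ.norm_le_of_mem_Ioo ht₂0 hτ y)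
      hu hv t ⟨ht.1, htt₂⟩
  exact Measure.eq_of_ae_eq hae (hV.continuous_slice ht0) continuous_const

/-! ### Backward propagation along the zoom -/

/-- **One zoom down.** For an exactly `c`-DSS field (`c ≠ 0`), `V(c² s, z) = c⁻¹ V(s, c⁻¹ z)`; in
particular a zero slice at time `s` forces a zero slice at time `c² s`. [folklore] -/
theorem sliceNonzero_zoom_down {c : ℝ} (hc : c ≠ 0)
    {V : ℝ → EuclideanSpace ℝ (Fin 3) → EuclideanSpace ℝ (Fin 3)}
    (hdss : IsDiscretelySelfSimilar c V) {s : ℝ} (hs : V s = 0) : V (c ^ 2 * s) = 0 := by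
  funext z
  have key := congrFun (congrFun hdss s) (c⁻¹ • z)
  rw [nsRescale_apply, smul_inv_smul₀ hc, hs, Pi.zero_apply] at key
  exact (smul_eq_zero_iff_right hc).1 key

/-- **Backward propagation.** For an exactly `c`-DSS field (`c > 1`) vanishing on `(t₁, 0)`
(`t₁ < 0`): `V(t) = 0` for every `t < 0` — every negative time `t` satisfies
`(c²)ᵏ t₁ < t` for some `k`, and the vanishing climbs from `((c²)ᵏ t₁, 0)` to `((c²)ᵏ⁺¹ t₁, 0)`
one zoom at a time. [folklore] -/
theorem sliceNonzero_backward {c : ℝ} (hc : 1 < c)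
    {V : ℝ → EuclideanSpace ℝ (Fin 3) → EuclideanSpace ℝ (Fin 3)}
    (hdss : IsDiscretelySelfSimilar c V) {t₁ : ℝ} (ht₁ : t₁ < 0)
    (hfwd : ∀ t ∈ Ioo t₁ 0, V t = 0) : ∀ t < 0, V t = 0 := by
  have hc0 : 0 < c := one_pos.trans hc
  have hq : 1 < c ^ 2 := by nlinarith
  have hq0 : 0 < c ^ 2 := by positivity
  -- climbing along the powers of the zoom
  have hall : ∀ k : ℕ, ∀ t : ℝ, (c ^ 2) ^ k * t₁ < t → t < 0 → V t = 0 := by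
    intro k
    induction k with
    | zero =>
        intro t h1 h2
        rw [pow_zero, one_mul] at h1
        exact hfwd t ⟨h1, h2⟩
    | succ k ih =>
        intro t h1 h2
        have hs1 : (c ^ 2) ^ k * t₁ < t / c ^ 2 := by
          rw [lt_div_iff₀ hq0, mul_right_comm, ← pow_succ]
          exact h1
        have hs2 : t / c ^ 2 < 0 := div_neg_of_neg_of_pos h2 hq0
        have e : c ^ 2 * (t / c ^ 2) = t := mul_div_cancel₀ t hq0.ne'
        rw [← e]
        exact sliceNonzero_zoom_down hc0.ne' hdss (ih _ hs1 hs2)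
  intro t ht
  obtain ⟨k, hk⟩ := pow_unbounded_of_one_lt (t / t₁) hq
  refine hall k t ?_ ht
  rwa [div_lt_iff_of_neg ht₁] at hk

/-! ### The registered stub -/

/-- **REGISTERED STUB `stub_sliceNonzero` (N4): every negative slice of a witness is nontrivial.**
If an ancient mild solution `u` (duality form, measurable slices), exactly `c`-DSS (`c > 1`) with a
Type-I space–time bound `HasTypeIDecay C₀ u`, has ONE negative slice `u(t₁)` a.e. zero, then all
its negative slices are a.e. zero. Proof: the smooth Oseen-gauge representative `V`
(`stub_smoothRepresentative_ae`) is exactly `c`-DSS (`stub_transport_ae`, trivial group); its slice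
`V(t₁)` is continuous and a.e. zero, hence zero; forward on `(t₁, 0)` by uniqueness of bounded
solutions of the Oseen integral equation from the zero datum (`sliceNonzero_forward`, KNSS 2009 §4),
backward along the zoom (`sliceNonzero_backward`); finally `u(t) = V(t) = 0` a.e.
[cite: KochNadirashviliSereginSverak2009, §4] -/
theorem stub_sliceNonzero :
    ∀ (c : ℝ) (u : ℝ → EuclideanSpace ℝ (Fin 3) → EuclideanSpace ℝ (Fin 3)) (C₀ : ℝ), 1 < c →
      IsAncientMildSolution 1 u → (∀ t < 0, AEStronglyMeasurable (u t) volume) →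
      IsDiscretelySelfSimilar c u → HasTypeIDecay C₀ u →
      (∃ t₁ < 0, u t₁ =ᵐ[volume] 0) → ∀ t < 0, u t =ᵐ[volume] 0 := by
  intro c u C₀ hc hanc hmeas hdss hdec hex t ht
  obtain ⟨t₁, ht₁, hut₁⟩ := hex
  -- the smooth representative and its self-similarity
  obtain ⟨V, C, hV, -, hae, hzero⟩ := stub_smoothRepresentative_ae u C₀ hanc hmeas hdec
  have hequ : ∀ g ∈ (⊥ : Subgroup (EuclideanSpace ℝ (Fin 3) ≃ₗᵢ[ℝ] EuclideanSpace ℝ (Fin 3))),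
      ∀ s x, u s (g x) = g (u s x) := by
    intro g hg s x
    rw [Subgroup.mem_bot] at hg
    subst hg
    simp
  have hdssV : IsDiscretelySelfSimilar c V :=
    (stub_transport_ae ⊥ c u V C hc hdss hequ hV hae hzero).1
  -- the vanishing slice of the representative
  have hV1 : V t₁ = 0 :=
    Measure.eq_of_ae_eq ((hae t₁ ht₁).trans hut₁) (hV.continuous_slice ht₁) continuous_const
  -- forward and backward
  have hVall : ∀ s < 0, V s = 0 :=
    sliceNonzero_backward hc hdssV ht₁ (sliceNonzero_forward hV hV1)
  have h := hae t ht
  rw [hVall t ht] at h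
  exact h.symm

end Summit.NavierStokesRegularity.NavierStokesRegularity.Theorems.PolyhedralDssProfileExists.PolyhedralCell

end
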